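import Mathlib
import Summits.CriticalPhenomena.PercolationContinuityZ3.Theorems.PercNearOneGluingNoHeavyLowerTailNeutralHurwitzTN
import Summits.CriticalPhenomena.PercolationContinuityZ3.Theorems.PercNearOneGluingNoHeavyLowerTailEqualRatioPeel
import HarnessLib

/-!
# THEOREM R^neut: the operator Hurwitz matrix `R(W)` of neutral copies is totally nonnegative

Support file for the Sahi / Conjecture-P programme of route `PercNearOneGluingNoHeavy`
(`--supports stmt-CriticalPhenomena-4575`, prover prim-l12-p5 gen 49; proof notes
`prim-l12-p5/PROOF-NEUTRAL-HURWITZ-g47.md` §2 and `prim-l12-p5/PROOF-NEUTRAL-HURWITZ-LEAN-g49.md`).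
No definitions, no named facts, no sorries.

* `DiffHurwitz.neutral_hurwitz_tn`: for `T = k+1` neutral copies with idle weights `0 < b_0 < … < b_k` at level
  `q > 0`, the λ-free band matrix `W(m, l) = [l ≤ m]·e_{m-l}(b)·m^{(m-l)}·(q+m)_{T-(m-l)}/(q)_T` (g45 (1.2), g46 §0,
  closed form g47 (2.1); `e_d(b) = [X^d]∏(1 + b_σ X)`) has a totally nonnegative operator Hurwitz matrix
  `R(W)` — rows `2m ↦ W(m,·)`, `2m+1 ↦ W(m+1,·) - W(m,·-1)` (the commutator rows `[S, W]`).  Proof: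
  `R(W)(t, l) = ρ(t)·K(t, l)·κ(l)` with the kernel `K` of `DiffHurwitz.neutral_hurwitz_kernel_tn` and positive
  factors (`u(m) = m!/(q)_m`, `v(l) = (q)_{T+l}/l!`).
* `DiffHurwitz.neutral_hurwitz_tn_all`: the same for ARBITRARY positive idle weights (repetitions allowed) —
  sort the weights (`sort_weights`, `Tuple.sort`), perturb to `b_σ + ε(σ+1)`, and let `ε → 0⁺` (every minor is
  a polynomial in `ε`).  This is CONJECTURE R of g46 for any number of neutral copies (THEOREM R^neut of g47).
* `DiffHurwitz.neutral_peel_tn`: COROLLARY N of g47 in peeled form — by the REDUCTION THEOREM of g46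
  (`DiffHurwitz.peel_tn`), `(p + g'n)W(n,l) + (1-g')n(W(n,l) - W(n-1,l-1)) + b'n W(n-1,l)` (`= p·W_{T+1}^{(p)}`,
  i.e. `𝒪₀` of the `T` neutral copies plus one arbitrary sub-neutral copy `b' + g'X`, up to positive diagonal
  factors) is totally nonnegative.
-/

namespace Summit.CriticalPhenomena.PercolationContinuityZ3.Theorems

namespace DiffHurwitz

open Finset Polynomial FallingMesh

/-- Splitting a rising-factorial product: `∏_{i<n+j}(q+i) = ∏_{i<n}(q+i) · ∏_{i<j}(q+n+i)`. -/
theorem prod_range_add_shift (q : ℝ) (n j : ℕ) :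
    ∏ i ∈ range (n + j), (q + (i : ℝ)) = (∏ i ∈ range n, (q + (i : ℝ))) * ∏ i ∈ range j, (q + (n : ℝ) + (i : ℝ)) := by
  rw [prod_range_add]
  congr 1
  refine prod_congr rfl fun i _ => ?_
  push_cast; ring

/-- **THEOREM R^neut.**  Let `0 < b_0 < … < b_k` be the idle weights of `T = k+1` neutral copies, `q > 0`,
`e_d = [X^d]∏_{σ≤k}(1 + b_σX)`, and let
`W(m, l) = [l ≤ m]·e_{m-l}·m^{(m-l)}·∏_{i < T-(m-l)}(q+m+i) / ∏_{i<T}(q+i)`  (`= e_{m-l} m^{(m-l)} (q+m)_{T-(m-l)}/(q)_T`)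
be their λ-free band matrix (g47 (2.1)).  Then the operator Hurwitz matrix — rows `2m ↦ W(m,·)`,
`2m+1 ↦ W(m+1,·) - W(m,·-1)` — is totally nonnegative. -/
theorem neutral_hurwitz_tn (k : ℕ) (b : ℕ → ℝ) (hb0 : 0 < b 0) (hb : StrictMono b) (q : ℝ) (hq : 0 < q)
    (e : ℕ → ℝ) (he : ∀ d, e d = (∏ σ ∈ range (k + 1), (1 + C (b σ) * X)).coeff d)
    (W : ℕ → ℕ → ℝ)
    (hW : ∀ m l, W m l = if l ≤ m then e (m - l) * (m.descFactorial (m - l) : ℝ) *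
      (∏ i ∈ range (k + 1 - (m - l)), (q + (m : ℝ) + (i : ℝ))) / ∏ i ∈ range (k + 1), (q + (i : ℝ)) else 0)
    {m : ℕ} (r s : Fin m → ℕ) (hr : StrictMono r) (hs : StrictMono s) :
    0 ≤ (Matrix.of fun i j =>
      if r i % 2 = 0 then W (r i / 2) (s j)
      else W (r i / 2 + 1) (s j) - if 1 ≤ s j then W (r i / 2) (s j - 1) else 0).det := by
  -- rising factorial products and the scalings u, v
  set P : ℕ → ℝ := fun n => ∏ i ∈ range n, (q + (i : ℝ)) with hP
  have hPpos : ∀ n, 0 < P n := fun n => prod_pos fun i _ => by positivity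
  have hPsucc : ∀ n, P (n + 1) = P n * (q + n) := fun n => by simp only [hP]; rw [prod_range_succ]
  set u : ℕ → ℝ := fun n => (n.factorial : ℝ) / P n with hu
  set v : ℕ → ℝ := fun l => P (k + 1 + l) / (l.factorial : ℝ) with hv
  have hupos : ∀ n, 0 < u n := fun n => div_pos (by positivity) (hPpos n)
  have hvpos : ∀ l, 0 < v l := fun l => div_pos (hPpos _) (by positivity)
  have husucc : ∀ n, u (n + 1) = u n * ((n : ℝ) + 1) / (q + n) := by
    intro n
    have h1 : P n ≠ 0 := ne_of_gt (hPpos n)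
    have h2 : q + (n : ℝ) ≠ 0 := by positivity
    simp only [hu]; rw [hPsucc, Nat.factorial_succ]; push_cast; field_simp
  have hvsucc : ∀ l, v l = v (l + 1) * ((l : ℝ) + 1) / (q + k + 1 + l) := by
    intro l
    have h1 : ((l.factorial : ℕ) : ℝ) ≠ 0 := by positivity
    have h2 : q + (k : ℝ) + 1 + l ≠ 0 := by positivity
    simp only [hv]; rw [show k + 1 + (l + 1) = (k + 1 + l) + 1 by ring, hPsucc, Nat.factorial_succ]
    push_cast; field_simp; ring
  -- vanishing of e beyond degree k+1
  have hedeg : ∀ d, k + 1 < d → e d = 0 := by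
    intro d hd
    rw [he]
    refine coeff_eq_zero_of_natDegree_lt (lt_of_le_of_lt ?_ hd)
    refine le_trans (natDegree_prod_le _ _) ?_
    refine le_trans (sum_le_sum (fun σ _ => show (1 + C (b σ) * X).natDegree ≤ 1 from ?_)) (by simp)
    rw [add_comm, ← C_1]; exact natDegree_linear_le
  -- the factored form of W
  have hWf : ∀ n l, W n l = if l ≤ n then (P (k + 1))⁻¹ * u n * v l * e (n - l) else 0 := by
    intro n l
    rw [hW]
    split_ifs with hl
    · obtain ⟨d, rfl⟩ := Nat.exists_eq_add_of_le hl
      rw [show l + d - l = d by omega]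
      rcases Nat.lt_or_ge (k + 1) d with hd | hd
      · rw [hedeg d hd]; ring
      · have hfac : ((l + d).descFactorial d : ℝ) * (l.factorial : ℝ) = ((l + d).factorial : ℝ) := by
          rw [← Nat.cast_mul]
          have := Nat.factorial_mul_descFactorial (show d ≤ l + d by omega)
          rw [show l + d - d = l by omega] at this
          exact_mod_cast (by rw [mul_comm]; exact this)
        have hsplit : P (k + 1 + l) = P (l + d) * ∏ i ∈ range (k + 1 - d), (q + ((l + d : ℕ) : ℝ) + (i : ℝ)) := by
          simp only [hP]
          rw [show k + 1 + l = (l + d) + (k + 1 - d) by omega, prod_range_add_shift]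
        have h1 : P (k + 1) ≠ 0 := ne_of_gt (hPpos _)
        have h2 : P (l + d) ≠ 0 := ne_of_gt (hPpos _)
        have h3 : ((l.factorial : ℕ) : ℝ) ≠ 0 := by positivity
        simp only [hu, hv]
        rw [hsplit, div_eq_iff h1]
        field_simp
        rw [← hfac]
        ring
    · rfl
  -- R(W) = ρ(t) · K(t,l) · κ(l)
  set ρ : ℕ → ℝ := fun t => if t % 2 = 0 then (P (k + 1))⁻¹ * u (t / 2) else (P (k + 1))⁻¹ * u (t / 2) / (q + ((t / 2 : ℕ) : ℝ))
    with hρ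
  set κ : ℕ → ℝ := fun l => v l / (q + k + l) with hκ
  have hρpos : ∀ t, 0 < ρ t := fun t => by
    simp only [hρ]; split_ifs
    · exact mul_pos (inv_pos.2 (hPpos _)) (hupos _)
    · exact div_pos (mul_pos (inv_pos.2 (hPpos _)) (hupos _)) (by positivity)
  have hκpos : ∀ l, 0 < κ l := fun l => div_pos (hvpos l) (by positivity)
  have hK : ∀ t l, (if t % 2 = 0 then W (t / 2) l else W (t / 2 + 1) l - if 1 ≤ l then W (t / 2) (l - 1) else 0)
      = ρ t * (if t % 2 = 0 then (if l ≤ t / 2 then (q + k + l) * e (t / 2 - l) else 0)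
          else (if l ≤ t / 2 + 1 then ((((t / 2 : ℕ) : ℝ) + 1) * (q + k) + (1 - q) * l) * e (t / 2 + 1 - l) else 0))
        * κ l := by
    intro t l
    have hql : q + (k : ℝ) + l ≠ 0 := by positivity
    by_cases hpar : t % 2 = 0
    · simp only [if_pos hpar, hρ, hκ, hWf]
      split_ifs with hl
      · field_simp
      · ring
    · simp only [if_neg hpar, hρ, hκ]
      set n := t / 2 with hn
      have hqn : q + (n : ℝ) ≠ 0 := by positivity
      rw [hWf]
      by_cases hl : l ≤ n + 1
      · rw [if_pos hl, if_pos hl]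
        rcases Nat.eq_zero_or_pos l with hl0 | hlpos
        · subst hl0
          rw [if_neg (by omega), sub_zero, Nat.sub_zero, husucc]
          push_cast; field_simp; ring
        · obtain ⟨l', rfl⟩ : ∃ l', l = l' + 1 := ⟨l - 1, by omega⟩
          rw [if_pos (by omega), hWf, show l' + 1 - 1 = l' by omega, if_pos (by omega),
            show n - l' = n + 1 - (l' + 1) by omega, husucc, hvsucc l']
          push_cast; field_simp; ring
      · rw [if_neg hl, if_neg hl]
        by_cases hl1 : 1 ≤ l
        · rw [if_pos hl1, hWf, if_neg (by omega)]; ring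
        · rw [if_neg hl1]; ring
  have heq : (Matrix.of fun i j =>
      if r i % 2 = 0 then W (r i / 2) (s j)
      else W (r i / 2 + 1) (s j) - if 1 ≤ s j then W (r i / 2) (s j - 1) else 0) =
      Matrix.of fun i j => ρ (r i) * (if r i % 2 = 0 then (if s j ≤ r i / 2 then (q + k + s j) * e (r i / 2 - s j) else 0)
          else (if s j ≤ r i / 2 + 1 then ((((r i / 2 : ℕ) : ℝ) + 1) * (q + k) + (1 - q) * s j) * e (r i / 2 + 1 - s j)
            else 0)) * κ (s j) := by
    ext i j; rw [Matrix.of_apply, Matrix.of_apply]; exact hK (r i) (s j)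
  rw [heq, TNKernel.det_kernel_scale (fun t l => if t % 2 = 0 then (if l ≤ t / 2 then (q + k + l) * e (t / 2 - l) else 0)
      else (if l ≤ t / 2 + 1 then ((((t / 2 : ℕ) : ℝ) + 1) * (q + k) + (1 - q) * l) * e (t / 2 + 1 - l) else 0)) ρ κ r s]
  exact mul_nonneg (prod_nonneg fun i _ => (hρpos _).le)
    (mul_nonneg (prod_nonneg fun j _ => (hκpos _).le) (neutral_hurwitz_kernel_tn k b hb0 hb q hq e he r s hr hs))

/-- A sorted, extended copy of finitely many reals: `bs` is monotone on `ℕ`, agrees with `b ∘ σ` on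
`range (k+1)` for a permutation `σ`, and the symmetric polynomial `∏(1 + b_σ X)` is unchanged. -/
theorem sort_weights (k : ℕ) (b : ℕ → ℝ) (hb : ∀ i, i < k + 1 → 0 < b i) :
    ∃ bs : ℕ → ℝ, Monotone bs ∧ 0 < bs 0 ∧
      ∏ σ ∈ range (k + 1), (1 + C (b σ) * X) = ∏ σ ∈ range (k + 1), (1 + C (bs σ) * X) := by
  set bf : Fin (k + 1) → ℝ := fun i => b i with hbf
  set π := Tuple.sort bf with hπ
  have hmono := Tuple.monotone_sort bf
  set bs : ℕ → ℝ := fun i => if h : i < k + 1 then bf (π ⟨i, h⟩) else bf (π (Fin.last k)) + i with hbs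
  refine ⟨bs, fun i j hij => ?_, ?_, ?_⟩
  · simp only [hbs]
    by_cases hi : i < k + 1
    · by_cases hj : j < k + 1
      · rw [dif_pos hi, dif_pos hj]; exact hmono (Fin.mk_le_mk.2 hij)
      · rw [dif_pos hi, dif_neg hj]
        have h1 : bf (π ⟨i, hi⟩) ≤ bf (π (Fin.last k)) := hmono (Fin.le_last _)
        have h2 : (0 : ℝ) ≤ j := Nat.cast_nonneg j
        change (bf ∘ π) ⟨i, hi⟩ ≤ (bf ∘ π) (Fin.last k) + j
        linarith [show (bf ∘ π) ⟨i, hi⟩ ≤ (bf ∘ π) (Fin.last k) from h1]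
    · have hj : ¬ j < k + 1 := by omega
      rw [dif_neg hi, dif_neg hj]
      have : (i : ℝ) ≤ j := by exact_mod_cast hij
      linarith
  · simp only [hbs, dif_pos (Nat.succ_pos k)]
    exact hb _ (π ⟨0, Nat.succ_pos k⟩).isLt
  · rw [← Fin.prod_univ_eq_prod_range (fun σ => 1 + C (b σ) * X) (k + 1),
      ← Fin.prod_univ_eq_prod_range (fun σ => 1 + C (bs σ) * X) (k + 1),
      ← Equiv.prod_comp π (fun i : Fin (k + 1) => 1 + C (b i) * X)]
    refine Fintype.prod_congr _ _ fun i => ?_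
    simp only [hbs, dif_pos i.isLt, hbf, Fin.eta]

/-- **THEOREM R^neut for arbitrary positive idle weights.**  As `neutral_hurwitz_tn`, but the idle weights
`b_0, …, b_k > 0` need not be distinct or ordered: the operator Hurwitz matrix `R(W)` of the λ-free band matrix of
`T = k+1` neutral copies at level `q > 0` is totally nonnegative.  (Sort the weights and perturb them to
`b_σ + ε(σ+1)`; every minor is a polynomial in `ε`, nonnegative for `ε > 0` by `neutral_hurwitz_tn`, hence at `ε = 0`.) -/
theorem neutral_hurwitz_tn_all (k : ℕ) (b : ℕ → ℝ) (hb : ∀ i, i < k + 1 → 0 < b i) (q : ℝ) (hq : 0 < q)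
    (e : ℕ → ℝ) (he : ∀ d, e d = (∏ σ ∈ range (k + 1), (1 + C (b σ) * X)).coeff d)
    (W : ℕ → ℕ → ℝ)
    (hW : ∀ m l, W m l = if l ≤ m then e (m - l) * (m.descFactorial (m - l) : ℝ) *
      (∏ i ∈ range (k + 1 - (m - l)), (q + (m : ℝ) + (i : ℝ))) / ∏ i ∈ range (k + 1), (q + (i : ℝ)) else 0)
    {m : ℕ} (r s : Fin m → ℕ) (hr : StrictMono r) (hs : StrictMono s) :
    0 ≤ (Matrix.of fun i j =>
      if r i % 2 = 0 then W (r i / 2) (s j)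
      else W (r i / 2 + 1) (s j) - if 1 ≤ s j then W (r i / 2) (s j - 1) else 0).det := by
  obtain ⟨bs, hbsm, hbs0, hprod⟩ := sort_weights k b hb
  -- the two-variable polynomial F(Y)(X) = ∏ (1 + (bs_σ + (σ+1)Y) X) and its specialisations
  set F : Polynomial (Polynomial ℝ) :=
    ∏ σ ∈ range (k + 1), (1 + C (C (bs σ) + C ((σ : ℝ) + 1) * X) * X) with hF
  set bε : ℝ → ℕ → ℝ := fun ε σ => bs σ + ε * ((σ : ℝ) + 1) with hbε
  have hFmap : ∀ ε, F.map (evalRingHom ε) = ∏ σ ∈ range (k + 1), (1 + C (bε ε σ) * X) := by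
    intro ε
    rw [hF, Polynomial.map_prod]
    refine prod_congr rfl fun σ _ => ?_
    simp [hbε, Polynomial.map_add, Polynomial.map_mul, mul_comm]
  set eε : ℝ → ℕ → ℝ := fun ε d => (F.coeff d).eval ε with heε
  have heε_coeff : ∀ ε d, eε ε d = (∏ σ ∈ range (k + 1), (1 + C (bε ε σ) * X)).coeff d := by
    intro ε d; rw [← hFmap, Polynomial.coeff_map]; rfl
  have hprod0 : (∏ σ ∈ range (k + 1), (1 + C (bε 0 σ) * X)) = ∏ σ ∈ range (k + 1), (1 + C (bs σ) * X) :=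
    prod_congr rfl fun σ _ => by simp [hbε]
  have he0 : ∀ d, eε 0 d = e d := by
    intro d
    rw [heε_coeff, he, hprod, hprod0]
  set Wε : ℝ → ℕ → ℕ → ℝ := fun ε n l => if l ≤ n then eε ε (n - l) * (n.descFactorial (n - l) : ℝ) *
      (∏ i ∈ range (k + 1 - (n - l)), (q + (n : ℝ) + (i : ℝ))) / ∏ i ∈ range (k + 1), (q + (i : ℝ)) else 0 with hWε
  set A : ℝ → Matrix (Fin m) (Fin m) ℝ := fun ε => Matrix.of fun i j =>
      if r i % 2 = 0 then Wε ε (r i / 2) (s j)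
      else Wε ε (r i / 2 + 1) (s j) - if 1 ≤ s j then Wε ε (r i / 2) (s j - 1) else 0 with hA
  -- at ε = 0 this is the matrix of the statement
  have hA0 : A 0 = Matrix.of fun i j =>
      if r i % 2 = 0 then W (r i / 2) (s j)
      else W (r i / 2 + 1) (s j) - if 1 ≤ s j then W (r i / 2) (s j - 1) else 0 := by
    have hW0 : ∀ n l, Wε 0 n l = W n l := fun n l => by rw [hW]; simp only [hWε, he0]
    ext i j; simp only [hA, Matrix.of_apply, hW0]
  -- for ε > 0 the weights are distinct and sorted: TN
  have hpos : ∀ ε, 0 < ε → 0 ≤ (A ε).det := by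
    intro ε hε
    have hsm : StrictMono (bε ε) := by
      intro i j hij
      simp only [hbε]
      have h1 := hbsm hij.le
      have h2 : (i : ℝ) + 1 < j + 1 := by exact_mod_cast Nat.succ_lt_succ hij
      nlinarith
    have h0 : 0 < bε ε 0 := by simp only [hbε]; push_cast; linarith
    exact neutral_hurwitz_tn k (bε ε) h0 hsm q hq (eε ε) (heε_coeff ε) (Wε ε) (fun n l => rfl) r s hr hs
  -- continuity in ε
  have hcont : Continuous fun ε => (A ε).det := by
    refine Continuous.matrix_det (continuous_pi fun i => continuous_pi fun j => ?_)
    have hWc : ∀ n l, Continuous fun ε => Wε ε n l := by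
      intro n l
      simp only [hWε]
      split_ifs
      · exact (((Polynomial.continuous _).mul continuous_const).mul continuous_const).div_const _
      · exact continuous_const
    simp only [hA, Matrix.of_apply]
    split_ifs
    · exact hWc _ _
    · exact (hWc _ _).sub (hWc _ _)
    · exact (hWc _ _).sub continuous_const
  -- limit ε → 0⁺
  rw [← hA0]
  refine ge_of_tendsto (x := nhdsWithin (0 : ℝ) (Set.Ioi 0))
    ((hcont.tendsto 0).mono_left nhdsWithin_le_nhds) ?_
  exact eventually_nhdsWithin_of_forall fun ε hε => hpos ε hε

/-- **COROLLARY N (peeled form).**  For `T = k+1` neutral copies (idle weights `b_σ > 0`) at level `p + 1`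
(`p > 0`) with band matrix `W` as in `neutral_hurwitz_tn_all`, and one further sub-neutral copy `φ = b' + g'X` (`b' ≥ 0`,
`0 ≤ g' ≤ 1`), the kernel `(n,l) ↦ (p + g'n)·W(n,l) + (1-g')·n·(W(n,l) - W(n-1,l-1)) + b'·n·W(n-1,l)` — which is
`p·W_{T+1}^{(p)}` by the copy-peeling identity g46 (1.2), i.e. `𝒪₀` of the `T+1` copies up to positive diagonal
factors — is totally nonnegative (`peel_tn` applied to `neutral_hurwitz_tn_all`). -/
theorem neutral_peel_tn (k : ℕ) (b : ℕ → ℝ) (hb : ∀ i, i < k + 1 → 0 < b i) (p : ℝ) (hp : 0 < p)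
    (e : ℕ → ℝ) (he : ∀ d, e d = (∏ σ ∈ range (k + 1), (1 + C (b σ) * X)).coeff d)
    (W : ℕ → ℕ → ℝ)
    (hW : ∀ m l, W m l = if l ≤ m then e (m - l) * (m.descFactorial (m - l) : ℝ) *
      (∏ i ∈ range (k + 1 - (m - l)), (p + 1 + (m : ℝ) + (i : ℝ))) / ∏ i ∈ range (k + 1), (p + 1 + (i : ℝ)) else 0)
    (b' g' : ℝ) (hb' : 0 ≤ b') (hg' : 0 ≤ g') (hh : g' ≤ 1)
    {m : ℕ} (r c : Fin m → ℕ) (hr : StrictMono r) (hc : StrictMono c) :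
    0 ≤ (Matrix.of fun i j => (p + g' * r i) * W (r i) (c j)
      + (1 - g') * r i * (W (r i) (c j) - if 1 ≤ c j then W (r i - 1) (c j - 1) else 0)
      + b' * r i * W (r i - 1) (c j)).det := by
  have hR := fun (k' : ℕ) (r' c' : Fin k' → ℕ) (hr' : StrictMono r') (hc' : StrictMono c') =>
    neutral_hurwitz_tn_all k b hb (p + 1) (by linarith) e he W hW r' c' hr' hc'
  have key := peel_tn W (fun n l => W (n + 1) l - if 1 ≤ l then W n (l - 1) else 0)
    (fun n => p + g' * n) (fun n => (1 - g') * n) (fun n => b' * n)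
    (fun n => by positivity) (fun n => mul_nonneg (by linarith) (Nat.cast_nonneg n))
    (fun n => mul_nonneg hb' (Nat.cast_nonneg n)) (by simp) (by simp) hR r c hr hc
  have hM : (Matrix.of fun i j => (p + g' * r i) * W (r i) (c j)
      + (1 - g') * r i * (W (r i) (c j) - if 1 ≤ c j then W (r i - 1) (c j - 1) else 0)
      + b' * r i * W (r i - 1) (c j))
      = Matrix.of fun i j => (p + g' * (r i : ℕ)) * W (r i) (c j)
        + (1 - g') * (r i : ℕ) * (W (r i - 1 + 1) (c j) - if 1 ≤ c j then W (r i - 1) (c j - 1) else 0)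
        + b' * (r i : ℕ) * W (r i - 1) (c j) := by
    ext i j
    simp only [Matrix.of_apply]
    rcases Nat.eq_zero_or_pos (r i) with h0 | h0
    · rw [h0]; simp
    · rw [Nat.sub_add_cancel h0]
  rw [hM]; exact key

end DiffHurwitz

end Summit.CriticalPhenomena.PercolationContinuityZ3.Theorems
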